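import Summits.Ventures.DiscreteObjects.Hadamard.MultiplierTMatrices668
import Mathlib.Algebra.Polynomial.Roots
import Mathlib.GroupTheory.OrderOfElement
import Mathlib.GroupTheory.Perm.Basic

/-!
# Hadamard 668 census — signed and permuted multipliers of circulant T-matrices of order 167, I: the multiplier is `-1`

Framing: lottery ticket; floor = certified bounds/negative ranges.

Cell pub-namedobj (venture DiscreteObjects), target (H), hadamard gen 25 (HANDOFF-H-g24 item 5b).  Gen 24 certified that
first rows `t_k : ZMod 167 → ℤ` of circulant T-matrices of order `167` cannot be INVARIANT under a non-trivial multiplier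
(`x ↦ -x`: `no_symmetric_tMatrixRows_167`; `x ↦ 4x`: `no_qrInvariant_tMatrixRows_167`).  The standard, weaker notion of a
multiplier of a quadruple of T-matrices lets the multiplier PERMUTE the four matrices and change SIGNS:
`t_{π k}(h x) = ε_k t_k(x)` for a unit `h`, a permutation `π` of the four rows and signs `ε_k = ±1`.  This file settles that
notion completely at `v = 167`:
* `signedMultiplier_iterate`, `invariant_pow48_of_signedMultiplier` — iterating the relation `24 = |S₄|`… more precisely
  using `π²⁴ = 1` twice, every such `t` is invariant under `h⁴⁸`;
* `exists_pow_eq_four` — an element `g ≠ 1` of `ZMod 167` with `g⁸³ = 1` has `4` among its powers (a degree-`83`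
  polynomial has at most `83` roots), so invariance under `g` gives invariance under the residue multiplier `4`;
* **`signedMultiplier_167_eq_neg_one`** — hence `h ∈ {0, 1, -1}`… for `h ≠ 0, 1`: a signed/permuted multiplier of
  circulant T-matrices of order `167` is necessarily `h = -1` (orders `83` and `166` are EXCLUDED, by reduction to gen 24);
* for `h = -1` (`t_{π k}(-x) = ε_k t_k(x)`), the tools of the census (completed in `SignedMultiplierTMatrices668Census`):
  the row `k₀` carrying the non-zero entry at `x = 0` is fixed by `π` with `ε_{k₀} = +1` (`fixed_of_negMultiplier`), row
  sums transform by `Σ t_{π k} = ε_k Σ t_k` (`rowSum_perm_of_negMultiplier`), and a `π`-fixed row vanishing at `0` has even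
  row sum — symmetric rows: `Σ ≡ t(0) (mod 2)`; skew rows: `Σ = 0` (`even_rowSum_of_fixed`).
STRUCTURE/NEGATIVE lines about a hypothetical object; no Hadamard order excluded; H(668) untouched; HITS 0/4.  Ours,
elementary; no `sorry`; `decide +kernel` only for `4⁸³ = 1` in `ZMod 167`.
-/

open Finset BigOperators

namespace Summit.Ventures.DiscreteObjects.Hadamard

open Literature.Combinatorics.Designs.LegendrePairs (PAF)
open Literature.Combinatorics.Designs.TSequences
open Literature.Combinatorics.Designs.TMatrices

/-! ## §1 Iterating a signed-permutation multiplier relation -/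

section Iterate

variable {n : ℕ} [NeZero n] {t : Fin 4 → ZMod n → ℤ} {h : ZMod n} {π : Equiv.Perm (Fin 4)} {ε : Fin 4 → ℤ}

omit [NeZero n] in
/-- iterating `t (π k) (h x) = ε_k t_k(x)`: `t (πᵐ k) (hᵐ x) = E_m(k) t_k(x)` with signs `E_m`. -/
lemma signedMultiplier_iterate (hε : ∀ k, ε k = 1 ∨ ε k = -1) (hmul : ∀ k x, t (π k) (h * x) = ε k * t k x) :
    ∀ m : ℕ, ∃ E : Fin 4 → ℤ, (∀ k, E k = 1 ∨ E k = -1) ∧ ∀ k x, t ((π ^ m) k) (h ^ m * x) = E k * t k x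
  | 0 => ⟨fun _ => 1, fun _ => Or.inl rfl, fun k x => by simp⟩
  | m + 1 => by
      obtain ⟨E, hE, hrel⟩ := signedMultiplier_iterate hε hmul m
      refine ⟨fun k => ε ((π ^ m) k) * E k, fun k => ?_, fun k x => ?_⟩
      · rcases hε ((π ^ m) k) with e | e <;> rcases hE k with e' | e' <;> simp [e, e']
      · rw [pow_succ', pow_succ', Equiv.Perm.mul_apply, mul_assoc, hmul, hrel, mul_assoc]

/-- every permutation of four letters satisfies `π²⁴ = 1` (`|S₄| = 24`). -/
lemma perm_fin4_pow_24 (π : Equiv.Perm (Fin 4)) : π ^ 24 = 1 := by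
  have hπ : π ^ Fintype.card (Equiv.Perm (Fin 4)) = 1 := pow_card_eq_one
  rwa [Fintype.card_perm, Fintype.card_fin, show Nat.factorial 4 = 24 by rfl] at hπ

omit [NeZero n] in
/-- **a signed/permuted multiplier `h` makes the rows invariant under `h⁴⁸`** (apply the iterate at `m = 24` twice: the
signs square away). -/
theorem invariant_pow48_of_signedMultiplier (hε : ∀ k, ε k = 1 ∨ ε k = -1)
    (hmul : ∀ k x, t (π k) (h * x) = ε k * t k x) : ∀ k x, t k (h ^ 48 * x) = t k x := by
  obtain ⟨E, hE, h24⟩ := signedMultiplier_iterate hε hmul 24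
  rw [perm_fin4_pow_24] at h24
  intro k x
  have e1 := h24 k (h ^ 24 * x)
  have e2 := h24 k x
  simp only [Equiv.Perm.coe_one, id_eq] at e1 e2
  rw [show h ^ 48 * x = h ^ 24 * (h ^ 24 * x) by rw [← mul_assoc, ← pow_add], e1, e2, ← mul_assoc]
  rcases hE k with e | e <;> simp [e]

omit [NeZero n] in
/-- invariance under `g` gives invariance under every power of `g`. -/
lemma invariant_pow_of_invariant {g : ZMod n} (hinv : ∀ k x, t k (g * x) = t k x) (k : Fin 4) (x : ZMod n) :
    ∀ j : ℕ, t k (g ^ j * x) = t k x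
  | 0 => by simp
  | j + 1 => by rw [pow_succ, mul_assoc, invariant_pow_of_invariant hinv k (g * x) j, hinv]

end Iterate

/-! ## §2 Elements of order 83 in `ZMod 167` reach the residue multiplier `4` -/

/-- `4 = 2²` is an `83`-rd root of unity in `ZMod 167` (Fermat). -/
lemma four_pow_83 : (4 : ZMod 167) ^ 83 = 1 := by
  decide +kernel

/-- **`4` is a power of every `g ≠ 1` with `g⁸³ = 1` in `ZMod 167`**: the `83` distinct powers of `g` and `4` are roots of
`X⁸³ - 1`, which has at most `83` roots in the field `ZMod 167`. -/
theorem exists_pow_eq_four {g : ZMod 167} (hg1 : g ≠ 1) (hg : g ^ 83 = 1) : ∃ j : ℕ, g ^ j = 4 := by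
  haveI : Fact (Nat.Prime 167) := ⟨by norm_num⟩
  haveI : Fact (Nat.Prime 83) := ⟨by norm_num⟩
  have hord : orderOf g = 83 := orderOf_eq_prime hg hg1
  by_contra hne
  simp only [not_exists] at hne
  set S : Finset (ZMod 167) := Finset.image (fun j : Fin 83 => g ^ (j : ℕ)) univ with hSdef
  have hS : S.card = 83 := by
    rw [hSdef, Finset.card_image_of_injective _ ?_, Finset.card_univ, Fintype.card_fin]
    intro a b hab
    apply Fin.ext
    have ha : (a : ℕ) < orderOf g := by rw [hord]; exact a.isLt
    have hb : (b : ℕ) < orderOf g := by rw [hord]; exact b.isLt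
    exact pow_injOn_Iio_orderOf ha hb hab
  have h4 : (4 : ZMod 167) ∉ S := fun hm => by
    obtain ⟨j, -, hj⟩ := Finset.mem_image.mp hm
    exact hne j hj
  have hsub : insert (4 : ZMod 167) S ⊆ (Polynomial.nthRoots 83 (1 : ZMod 167)).toFinset := by
    intro y hy
    rw [Multiset.mem_toFinset, Polynomial.mem_nthRoots (by norm_num)]
    rcases Finset.mem_insert.mp hy with rfl | hy'
    · exact four_pow_83
    · obtain ⟨j, -, rfl⟩ := Finset.mem_image.mp hy'
      rw [← pow_mul, mul_comm, pow_mul, hg, one_pow]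
  have hcard := Finset.card_le_card hsub
  rw [Finset.card_insert_of_notMem h4, hS] at hcard
  have hle := (Multiset.toFinset_card_le _).trans (Polynomial.card_nthRoots 83 (1 : ZMod 167))
  omega

/-! ## §3 Orders 83 and 166 are excluded: a signed/permuted multiplier of T-matrices of order 167 is `-1` -/

/-- **the multiplier is `-1`.**  If first rows of circulant T-matrices of order `167` satisfy
`t_{π k}(h x) = ε_k t_k(x)` (`h ≠ 0, 1`; `π` a permutation of the four rows; `ε_k = ±1`), then `h = -1`: otherwise `h⁴⁸ ≠ 1`
has order `83`, the rows are invariant under it (`invariant_pow48_of_signedMultiplier`), hence under `4`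
(`exists_pow_eq_four`), contradicting `no_qrInvariant_tMatrixRows_167`. -/
theorem signedMultiplier_167_eq_neg_one {t : Fin 4 → ZMod 167 → ℤ} (ht : IsTMatrixRows 167 t) {h : ZMod 167}
    (h0 : h ≠ 0) (h1 : h ≠ 1) {π : Equiv.Perm (Fin 4)} {ε : Fin 4 → ℤ} (hε : ∀ k, ε k = 1 ∨ ε k = -1)
    (hmul : ∀ k x, t (π k) (h * x) = ε k * t k x) : h = -1 := by
  by_contra hm1
  haveI : Fact (Nat.Prime 167) := ⟨by norm_num⟩
  have hinv := invariant_pow48_of_signedMultiplier hε hmul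
  have hF : h ^ 166 = 1 := by simpa using ZMod.pow_card_sub_one_eq_one h0
  have hg83 : (h ^ 48) ^ 83 = 1 := by
    rw [← pow_mul, show 48 * 83 = 166 * 24 by norm_num, pow_mul, hF, one_pow]
  have hg1 : h ^ 48 ≠ 1 := by
    intro h48
    have h2 : h * h = 1 := by
      have hgcd : h ^ Nat.gcd 48 166 = 1 := pow_gcd_eq_one.mpr ⟨h48, hF⟩
      rw [show Nat.gcd 48 166 = 2 by decide, pow_two] at hgcd
      exact hgcd
    rcases mul_self_eq_one_iff.mp h2 with e | e
    · exact h1 e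
    · exact hm1 e
  obtain ⟨j, hj⟩ := exists_pow_eq_four hg1 hg83
  have hinv4 : ∀ k x, t k (4 * x) = t k x := fun k x => by
    rw [← hj]
    exact invariant_pow_of_invariant hinv k x j
  exact no_qrInvariant_tMatrixRows_167 ⟨t, ht, hinv4⟩

/-- restated as a negative line: **no circulant T-matrices of order 167 admit a signed/permuted multiplier of order `83`
or `166`** (`h ∉ {0, 1, -1}`). -/
theorem no_signedMultiplier_167_of_ne_neg_one {h : ZMod 167} (h0 : h ≠ 0) (h1 : h ≠ 1) (hm1 : h ≠ -1) :
    ¬ ∃ (t : Fin 4 → ZMod 167 → ℤ) (π : Equiv.Perm (Fin 4)) (ε : Fin 4 → ℤ),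
      IsTMatrixRows 167 t ∧ (∀ k, ε k = 1 ∨ ε k = -1) ∧ ∀ k x, t (π k) (h * x) = ε k * t k x :=
  fun ⟨_, _, _, ht, hε, hmul⟩ => hm1 (signedMultiplier_167_eq_neg_one ht h0 h1 hε hmul)

/-! ## §4 The multiplier `-1` with a row permutation and signs -/

section NegOne

variable {n : ℕ} [NeZero n] {t : Fin 4 → ZMod n → ℤ} {π : Equiv.Perm (Fin 4)} {ε : Fin 4 → ℤ}

/-- row sums transform by `Σ t_{π k} = ε_k Σ t_k` under `t_{π k}(-x) = ε_k t_k(x)`. -/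
lemma rowSum_perm_of_negMultiplier (hmul : ∀ k x, t (π k) (-x) = ε k * t k x) (k : Fin 4) :
    ∑ x, t (π k) x = ε k * ∑ x, t k x := by
  rw [Finset.mul_sum]
  calc ∑ x, t (π k) x = ∑ x, t (π k) (-x) := (Fintype.sum_equiv (Equiv.neg (ZMod n)) _ _ fun x => by simp).symm
    _ = ∑ x, ε k * t k x := Finset.sum_congr rfl fun x _ => hmul k x

/-- hence `(Σ t_{π k})² = (Σ t_k)²`. -/
lemma rowSum_sq_perm_of_negMultiplier (hε : ∀ k, ε k = 1 ∨ ε k = -1) (hmul : ∀ k x, t (π k) (-x) = ε k * t k x)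
    (k : Fin 4) : (∑ x, t (π k) x) ^ 2 = (∑ x, t k x) ^ 2 := by
  rw [rowSum_perm_of_negMultiplier hmul k]
  rcases hε k with e | e <;> simp [e]

/-- **the row carrying the non-zero entry at `0` is fixed, with sign `+1`**. -/
lemma fixed_of_negMultiplier (ht : IsTMatrixRows n t) (hε : ∀ k, ε k = 1 ∨ ε k = -1)
    (hmul : ∀ k x, t (π k) (-x) = ε k * t k x) {k₀ : Fin 4} (hk₀ : t k₀ 0 ≠ 0) : π k₀ = k₀ ∧ ε k₀ = 1 := by
  obtain ⟨k, -, huniq⟩ := ht.1 0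
  have h0 := hmul k₀ 0
  rw [neg_zero] at h0
  have hπ : π k₀ = k₀ := by
    have hne : t (π k₀) 0 ≠ 0 := by
      rw [h0]; rcases hε k₀ with e | e <;> simp [e, hk₀]
    have e1 : π k₀ = k := by_contra fun hne' => hne (huniq _ hne')
    have e2 : k₀ = k := by_contra fun hne' => hk₀ (huniq _ hne')
    rw [e1, e2]
  refine ⟨hπ, ?_⟩
  rw [hπ] at h0
  rcases hε k₀ with e | e
  · exact e
  · exfalso; rw [e] at h0; apply hk₀; linarith

/-- **a `π`-fixed row vanishing at `0` has even row sum** (symmetric: `Σ ≡ t(0) = 0 (mod 2)`; skew: `Σ = 0`), `n` odd. -/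
lemma even_rowSum_of_fixed (hn : n % 2 = 1) (hε : ∀ k, ε k = 1 ∨ ε k = -1)
    (hmul : ∀ k x, t (π k) (-x) = ε k * t k x) {k : Fin 4} (hk : π k = k) (hk0 : t k 0 = 0) :
    Even (∑ x, t k x) := by
  have hrel : ∀ x, t k (-x) = ε k * t k x := fun x => by rw [← hmul k x, hk]
  rcases hε k with e | e
  · -- symmetric row
    have hsym : ∀ x, t k (-x) = t k x := fun x => by rw [hrel x, e, one_mul]
    have h2 := sum_symm_castTwo hn (t k) hsym
    rw [hk0, Int.cast_zero] at h2
    have hd := (ZMod.intCast_zmod_eq_zero_iff_dvd _ 2).mp h2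
    exact even_iff_two_dvd.mpr (by exact_mod_cast hd)
  · -- skew row: the sum is `0`
    have hS := rowSum_perm_of_negMultiplier hmul k
    rw [hk, e] at hS
    have : ∑ x, t k x = 0 := by linarith
    rw [this]; exact ⟨0, (add_zero 0).symm⟩

end NegOne

end Summit.Ventures.DiscreteObjects.Hadamard
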